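/-
Copyright (c) 2026 the pub-hodgecm-mathlib formalisation cell (harness21).  Prover seat hodgecm-mathlib-K2E1-p08 (g3), Track B ∕ K2-LIT
(build stream 29), h413 = `stmt-HodgeConjecture-24833`, line `K2_E1_TraceFormulaBeta`, socket module «GlobalIndex» ED. 11 — payer
programme of `sig_K2E1CuspCompactU3R` :278 (12C3), the (E3R) port, brick (B6₃: step domains of every level, both Heisenberg coordinates);
dealer K2E1-plan (g2) division of record 2026-09-04T01:03:26Z.  2026-09-04.
-/
import Summits.HodgeConjecture.HodgeConjecture.Theorems.K2E1SmoothedCuspFormZeroMeanU3   -- ★ p856148 (K2E1-p09 g2) B2₃: the Heisenberg currency (`heisChart`, `coordX`, `coordY`, `ratHeisElt`), §2 for `D_E × 𝓕⁻`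
import Summits.HodgeConjecture.HodgeConjecture.Theorems.K2E1SiegelStepDomainsU2         -- ★ p856209 (K2E1-p02 g2) B6: the CENTRE step domains `2cc̄ · 𝓕⁻ ⊂ 𝔸_L⁻` (reused BY NAME; brings ★ `integralFiniteAdeles`)
import Literature.NumberTheory.Automorphic.UnitaryGroupHeisenbergBorelConj                 -- ★ `coordX_inv`, `coe_coordY_inv` (`u(x,y)⁻¹ = u(−x,−y)`)
import HarnessLib

/-!
# h413 ∕ Track B «K2-LIT», line `K2_E1_TraceFormulaBeta`, «GlobalIndex» — brick B6₃ `K2E1SiegelStepDomainsU3` of the (E3R) payer programme: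
# step domains of every level for the QUOTIENT coordinate `N∕Z ≅ 𝔸_E` of the Heisenberg radical of `U(2,1)` (the scaled Tate domains `c · D_E`), and
# fundamental domains `u(D_Q × D_Z)` of `N(F)` in `N(𝔸_F)` over ARBITRARY uniquely-representing domains

Cell `pub/hodgecm-mathlib`, crux H413 = `stmt-HodgeConjecture-24833`, route of record `HCCMUnconditional`; chair K2-lead (g0), dealer K2E1-plan (g2),
division of record 2026-09-04T01:03:26Z («p08 (g3): (B6₃) `K2E1SiegelStepDomainsU3` NOW»; parallel to DEAL A = B3Q (K2E1-p09 (g3)) and DEAL B∕C (K2E1-p02 (g3))).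
The `U(2,1)` twin of K2E1-p02 (g2)'s ★ p856209 `K2E1SiegelStepDomainsU2` (brick B6) for the TWO-STEP radical `N ⊃ Z ⊃ 1`: the CENTRE coordinate `Z ≅ 𝔸_E⁻` is served by
★ p856209 `exists_stepDomain` BY NAME (`D_Z = 2cc̄ · 𝓕⁻`); this file adds the QUOTIENT coordinate `N∕Z ≅ 𝔸_E` and the Heisenberg bookkeeping over general domains, i.e. the
«one-line variants of B2₃ §2 with `c • adeleFundamentalDomain E`» asked for by K2E1-p09 (g2) (K2 bus 2026-09-04T00:42:37Z) in the shape the assembly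
`K2E1CuspSiegelEstimateCoreU3` consumes (template: the `hdom` binder of ★ p856177 `K2E1CuspSiegelEstimateCoreU2.exists_norm_orbitalSmoothing_le_of_domains`).
THEOREMS ONLY (no `def`, no `instance`, no `notation`, no named-fact hypothesis, no `sorry`); lane `--kind proof --supports stmt-HodgeConjecture-24833 --as helper`.

* §1 (any number field `E`) THE SCALED TATE DOMAINS `s · D_E ⊂ 𝔸_E` (`s ∈ E`, `s ≠ 0`; `D_E` = ★ `adeleFundamentalDomain E`) and their translates `v + s · D_E`:
  `mem_vadd_smul_adeleFundamentalDomain_iff` (`x ∈ v + s·D_E ↔ s⁻¹(x − v) ∈ D_E`), **`existsUnique_add_algebraMap_mem_vadd_smul_adeleFundamentalDomain`** (Tate's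
  Thm. 4.1.3 (1) transported along `x ↦ s⁻¹(x − v)`, `ξ ↦ s ξ`), measurability, relative compactness, positive finite Haar measure, and the LEVEL: for `s = c ∈ 𝓞 E` every
  point of `c · D_E` has finite part `c · y`, `y ∈ ∏_w 𝒪_w` (`snd_eq_of_mem_smul_adeleFundamentalDomain`); boxed as **`exists_stepDomain_adele`** (the quotient twin of ★
  p856209 `exists_stepDomain`, uniqueness in Tate's `ξ : E` form `∀ x, ∃! ξ, ξ + x ∈ D`).
* §2 (Mok's `quasiSplit F E c 3`, `c² = 1`) HEISENBERG FUNDAMENTAL DOMAINS OVER GENERAL DOMAINS: for `D_Q ⊆ 𝔸_E` uniquely representing for `E` and `D_Z ⊆ 𝔸_E⁻` uniquely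
  representing for `E⁻`, **`existsUnique_smul_mem_heisChart_image_prod`** — `u(D_Q × D_Z)` is a fundamental domain of `N(F)` in `N(𝔸_F)` (proof = ★ p856148 §2 verbatim:
  first the `x`-coordinate, then the centre); Borel ∕ relatively compact when `D_Q`, `D_Z` are; unique representability is stable under translates (`…_vadd`) and under
  NEGATION (`…_neg`, for the passage between the conventions `[g · u(x,y)⁻¹]` of B2₃ and `[x · u(x,y)]` of B3Z∕B3Q, `u(x,y)⁻¹ = u(−x,−y)`).

HONEST LABEL.  Count-neutral helper; closes no socket by itself; HC_CM is proved only modulo the 7 printed citations (2 remaining named inputs: hLiu418 =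
`stmt-HodgeConjecture-24832`, h413 = `stmt-HodgeConjecture-24833`) until rung 0 closes.

## References
* [CasselsFrohlichANT1967] J. W. S. Cassels, A. Fröhlich (eds.), *Algebraic Number Theory* (1967), Ch. XV (Tate), Def. 4.1.2, Thm. 4.1.3, Cor. 4.1.1.
* [Garrett2018] P. Garrett, *Modern Analysis of Automorphic Forms by Example* (2018), Thm. 7.3.10 (PDF p. 340: the scaled domain and the level).
* [Rogawski1990] J. D. Rogawski, *Automorphic Representations of Unitary Groups in Three Variables* (1990), §1.10 p. 9, §2.1 p. 12 (`N(F)∖N(𝔸)`).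
* [GetzHahn2024] J. R. Getz, H. Hahn, *An Introduction to Automorphic Representations*, GTM 300 (2024), Lemma 9.6.4, Prop. 9.6.1 (printed pp. 189–190).
-/

set_option autoImplicit false
-- the mandated namespace repeats `HodgeConjecture.HodgeConjecture`, as in every `Theorems/*.lean` of this sub-problem
set_option linter.dupNamespace false

noncomputable section

open NumberField IsDedekindDomain MeasureTheory Measure Filter Topology Set
open scoped NNReal Pointwise ENNReal

namespace Summit.HodgeConjecture.HodgeConjecture.Cruxes.H413.K2E1SiegelStepDomainsU3

open Literature.NumberTheory.Automorphic Literature.NumberTheory.Automorphic.UnitaryGroup AdelicGroupData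

/-! ## §1 The scaled Tate domains `s · D_E ⊂ 𝔸_E` and their translates (any number field `E`) -/

section ScaledTate

variable (E : Type) [Field E] [NumberField E]

/-- **Membership in a translate of a scaled Tate domain**: `x ∈ v + s · D_E ↔ s⁻¹ (x − v) ∈ D_E` (`s ∈ E`, `s ≠ 0`, acting through the principal adele
`algebraMap E 𝔸_E s`). [cite: CasselsFrohlichANT1967, Ch. XV Thm. 4.1.3 (1)] -/
theorem mem_vadd_smul_adeleFundamentalDomain_iff {s : E} (hs : s ≠ 0) {v x : AdeleRing (𝓞 E) E} :
    x ∈ v +ᵥ algebraMap E (AdeleRing (𝓞 E) E) s • adeleFundamentalDomain E ↔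
      algebraMap E (AdeleRing (𝓞 E) E) s⁻¹ * (x - v) ∈ adeleFundamentalDomain E := by
  rw [Set.mem_vadd_set]
  constructor
  · rintro ⟨y, hy, rfl⟩
    obtain ⟨d, hd, rfl⟩ := Set.mem_smul_set.1 hy
    rwa [vadd_eq_add, add_sub_cancel_left, smul_eq_mul, ← mul_assoc, ← map_mul, inv_mul_cancel₀ hs, map_one, one_mul]
  · intro h
    refine ⟨x - v, Set.mem_smul_set.2 ⟨_, h, ?_⟩, by rw [vadd_eq_add, add_sub_cancel]⟩
    rw [smul_eq_mul, ← mul_assoc, ← map_mul, mul_inv_cancel₀ hs, map_one, one_mul]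

/-- **Tate's Theorem 4.1.3 (1) for the translated scaled domains**: every adele is congruent modulo `E` to exactly one point of `v + s · D_E` — transport of ★
`existsUnique_add_algebraMap_mem_adeleFundamentalDomain` along `x ↦ s⁻¹(x − v)` and `ξ ↦ s ξ` (the map `ξ ↦ s ξ` is a bijection of `E`).
[cite: CasselsFrohlichANT1967, Ch. XV Thm. 4.1.3 (1)] -/
theorem existsUnique_add_algebraMap_mem_vadd_smul_adeleFundamentalDomain {s : E} (hs : s ≠ 0) (v x : AdeleRing (𝓞 E) E) :
    ∃! ξ : E, algebraMap E (AdeleRing (𝓞 E) E) ξ + x ∈ v +ᵥ algebraMap E (AdeleRing (𝓞 E) E) s • adeleFundamentalDomain E := by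
  -- the condition on `ξ` reads `s⁻¹ ξ + s⁻¹ (x − v) ∈ D_E`
  have hiff : ∀ ξ : E, algebraMap E (AdeleRing (𝓞 E) E) ξ + x ∈ v +ᵥ algebraMap E (AdeleRing (𝓞 E) E) s • adeleFundamentalDomain E ↔
      algebraMap E (AdeleRing (𝓞 E) E) (s⁻¹ * ξ) + algebraMap E (AdeleRing (𝓞 E) E) s⁻¹ * (x - v) ∈ adeleFundamentalDomain E := by
    intro ξ
    rw [mem_vadd_smul_adeleFundamentalDomain_iff E hs, add_sub_assoc, mul_add, map_mul]
  obtain ⟨ξ₀, hξ₀, huniq⟩ := existsUnique_add_algebraMap_mem_adeleFundamentalDomain E (algebraMap E (AdeleRing (𝓞 E) E) s⁻¹ * (x - v))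
  refine ⟨s * ξ₀, (hiff _).2 ?_, fun ξ hξ => ?_⟩
  · rw [← mul_assoc, inv_mul_cancel₀ hs, one_mul]
    exact hξ₀
  · have h := (hiff ξ).1 hξ
    rw [← huniq _ h, ← mul_assoc, mul_inv_cancel₀ hs, one_mul]

/-- The same for the principal-adele subgroup action (the `IsAddFundamentalDomain` shape): exactly one `E`-translate of every adele lies in `v + s · D_E`.
[cite: CasselsFrohlichANT1967, Ch. XV Thm. 4.1.3 (1)] -/
theorem existsUnique_vadd_mem_vadd_smul_adeleFundamentalDomain {s : E} (hs : s ≠ 0) (v x : AdeleRing (𝓞 E) E) :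
    ∃! g : AdeleRing.principalSubgroup (𝓞 E) E, g +ᵥ x ∈ v +ᵥ algebraMap E (AdeleRing (𝓞 E) E) s • adeleFundamentalDomain E := by
  obtain ⟨ξ, hξ, huniq⟩ := existsUnique_add_algebraMap_mem_vadd_smul_adeleFundamentalDomain E hs v x
  refine ⟨⟨algebraMap E _ ξ, ξ, rfl⟩, hξ, ?_⟩
  rintro ⟨g, ξ', rfl⟩ hg
  have : ξ' = ξ := huniq ξ' hg
  subst this
  rfl

/-- The translated scaled domains are Borel sets (preimages of the Borel `D_E`, ★ `measurableSet_adeleFundamentalDomain`, under the continuous `x ↦ s⁻¹(x − v)`).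
[cite: CasselsFrohlichANT1967, Ch. XV Thm. 4.1.3] -/
theorem measurableSet_vadd_smul_adeleFundamentalDomain [MeasurableSpace (AdeleRing (𝓞 E) E)] [BorelSpace (AdeleRing (𝓞 E) E)] {s : E} (hs : s ≠ 0)
    (v : AdeleRing (𝓞 E) E) : MeasurableSet (v +ᵥ algebraMap E (AdeleRing (𝓞 E) E) s • adeleFundamentalDomain E) := by
  have heq : v +ᵥ algebraMap E (AdeleRing (𝓞 E) E) s • adeleFundamentalDomain E =
      (fun x => algebraMap E (AdeleRing (𝓞 E) E) s⁻¹ * (x - v)) ⁻¹' adeleFundamentalDomain E := by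
    ext x
    exact mem_vadd_smul_adeleFundamentalDomain_iff E hs
  rw [heq]
  exact (measurableSet_adeleFundamentalDomain E).preimage ((continuous_const.mul (continuous_id.sub continuous_const)).measurable)

/-- **The translated scaled domains are relatively compact** (images of the compact `closure D_E`, ★ `isCompact_closure_adeleFundamentalDomain`, under `d ↦ v + s d`).
[cite: CasselsFrohlichANT1967, Ch. XV Cor. 4.1.1] -/
theorem exists_isCompact_vadd_smul_adeleFundamentalDomain_subset (s : E) (v : AdeleRing (𝓞 E) E) :
    ∃ K : Set (AdeleRing (𝓞 E) E), IsCompact K ∧ v +ᵥ algebraMap E (AdeleRing (𝓞 E) E) s • adeleFundamentalDomain E ⊆ K := by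
  refine ⟨(fun d => v + algebraMap E (AdeleRing (𝓞 E) E) s * d) '' closure (adeleFundamentalDomain E),
    (isCompact_closure_adeleFundamentalDomain E).image (continuous_const.add (continuous_const.mul continuous_id)), ?_⟩
  rintro _ ⟨_, ⟨d, hd, rfl⟩, rfl⟩
  exact ⟨d, subset_closure hd, rfl⟩

/-- The translated scaled domains have finite measure for every measure finite on compact sets. [cite: CasselsFrohlichANT1967, Ch. XV Thm. 4.1.3 (2)] -/
theorem measure_vadd_smul_adeleFundamentalDomain_lt_top [MeasurableSpace (AdeleRing (𝓞 E) E)] (s : E) (v : AdeleRing (𝓞 E) E) (ν : Measure (AdeleRing (𝓞 E) E))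
    [IsFiniteMeasureOnCompacts ν] : ν (v +ᵥ algebraMap E (AdeleRing (𝓞 E) E) s • adeleFundamentalDomain E) < ⊤ := by
  obtain ⟨K, hK, hsub⟩ := exists_isCompact_vadd_smul_adeleFundamentalDomain_subset E s v
  exact (measure_mono hsub).trans_lt hK.measure_lt_top

/-- **The translated scaled domains have positive Haar measure**: a measurable fundamental domain (Mathlib `IsAddFundamentalDomain.mk'`) of the countable group `E` for a
non-zero invariant measure (Mathlib `IsAddFundamentalDomain.measure_ne_zero`). [cite: CasselsFrohlichANT1967, Ch. XV Thm. 4.1.3] -/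
theorem measure_vadd_smul_adeleFundamentalDomain_ne_zero [MeasurableSpace (AdeleRing (𝓞 E) E)] [BorelSpace (AdeleRing (𝓞 E) E)] {s : E} (hs : s ≠ 0)
    (v : AdeleRing (𝓞 E) E) (ν : Measure (AdeleRing (𝓞 E) E)) [ν.IsAddHaarMeasure] :
    ν (v +ᵥ algebraMap E (AdeleRing (𝓞 E) E) s • adeleFundamentalDomain E) ≠ 0 := by
  haveI : Countable (AdeleRing.principalSubgroup (𝓞 E) E) := countable_principalSubgroup E
  exact (IsAddFundamentalDomain.mk' (measurableSet_vadd_smul_adeleFundamentalDomain E hs v).nullMeasurableSet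
    (existsUnique_vadd_mem_vadd_smul_adeleFundamentalDomain E hs v)).measure_ne_zero (NeZero.ne ν)

/-- **THE LEVEL of the scaled domain `c · D_E`** (`c ∈ 𝓞 E`): every point has finite part `c · y` with `y ∈ ∏_w 𝒪_w` (★ `integralFiniteAdeles`) — points of `D_E` are
finite-integral by definition (★ `mem_adeleFundamentalDomain`).  This is how the finite places drop out of the kernel estimate along the quotient coordinate
(`u(x_f, 0) ∈ K(𝔫)` for `x_f ∈ c · ∏_w 𝒪_w`). [cite: Garrett2018, Thm. 7.3.10 (PDF p. 340)] [cite: CasselsFrohlichANT1967, Ch. XV Def. 4.1.2] -/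
theorem snd_eq_of_mem_smul_adeleFundamentalDomain (c : 𝓞 E) {X : AdeleRing (𝓞 E) E}
    (hX : X ∈ algebraMap E (AdeleRing (𝓞 E) E) (c : E) • adeleFundamentalDomain E) :
    ∃ y ∈ integralFiniteAdeles E, X.2 = algebraMap (𝓞 E) (FiniteAdeleRing (𝓞 E) E) c * y := by
  obtain ⟨d, hd, rfl⟩ := Set.mem_smul_set.1 hX
  refine ⟨d.2, fun w => hd.1 w, ?_⟩
  have h2 : ∀ z w : AdeleRing (𝓞 E) E, (z * w).2 = z.2 * w.2 := fun z w => rfl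
  have halg : (algebraMap E (AdeleRing (𝓞 E) E) (c : E)).2 = algebraMap (𝓞 E) (FiniteAdeleRing (𝓞 E) E) c := by
    rw [IsScalarTower.algebraMap_apply (𝓞 E) E (FiniteAdeleRing (𝓞 E) E)]
    rfl
  rw [smul_eq_mul, h2, halg]

/-- **STEP DOMAINS OF EVERY LEVEL FOR THE QUOTIENT COORDINATE `N∕Z ≅ 𝔸_E`** (the quotient twin of ★ p856209 `K2E1SiegelStepDomainsU2.exists_stepDomain`, in the
shape of the `hdom` binder of ★ p856177): for `c ∈ 𝓞 E`, `c ≠ 0`, and an additive Haar measure `νX` on `𝔸_E` there are `D ⊆ K_D ⊆ 𝔸_E` with `D` measurable, `K_D` compact,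
`νX D ≠ 0`, every adele congruent modulo `E` to EXACTLY ONE point of `D` (Tate's form `∃! ξ : E, ξ + x ∈ D`), and every `X ∈ D` with finite part `c · y`, `y ∈ ∏_w 𝒪_w` —
namely `D = c · D_E`. [cite: CasselsFrohlichANT1967, Ch. XV Thm. 4.1.3] [cite: Garrett2018, Thm. 7.3.10 (PDF p. 340)] -/
theorem exists_stepDomain_adele (c : 𝓞 E) (hc0 : c ≠ 0) [MeasurableSpace (AdeleRing (𝓞 E) E)] [BorelSpace (AdeleRing (𝓞 E) E)]
    (νX : Measure (AdeleRing (𝓞 E) E)) [νX.IsAddHaarMeasure] :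
    ∃ D KD : Set (AdeleRing (𝓞 E) E),
      MeasurableSet D ∧ IsCompact KD ∧ D ⊆ KD ∧ νX D ≠ 0 ∧
      (∀ x : AdeleRing (𝓞 E) E, ∃! ξ : E, algebraMap E (AdeleRing (𝓞 E) E) ξ + x ∈ D) ∧
      (∀ X ∈ D, ∃ y ∈ integralFiniteAdeles E, X.2 = algebraMap (𝓞 E) (FiniteAdeleRing (𝓞 E) E) c * y) := by
  have hcE : (c : E) ≠ 0 := RingOfIntegers.coe_ne_zero_iff.mpr hc0
  obtain ⟨K, hK, hsub⟩ := exists_isCompact_vadd_smul_adeleFundamentalDomain_subset E (c : E) 0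
  refine ⟨algebraMap E (AdeleRing (𝓞 E) E) (c : E) • adeleFundamentalDomain E, K, ?_, hK, ?_, ?_, fun x => ?_,
    fun X hX => snd_eq_of_mem_smul_adeleFundamentalDomain E c hX⟩
  · simpa only [zero_vadd] using measurableSet_vadd_smul_adeleFundamentalDomain E hcE 0
  · simpa only [zero_vadd] using hsub
  · simpa only [zero_vadd] using measure_vadd_smul_adeleFundamentalDomain_ne_zero E hcE 0 νX
  · simpa only [zero_vadd] using existsUnique_add_algebraMap_mem_vadd_smul_adeleFundamentalDomain E hcE 0 x

end ScaledTate

/-! ## §2 Fundamental domains `u(D_Q × D_Z)` of `N(F)` in `N(𝔸_F)` over general uniquely-representing domains -/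

section Heisenberg

variable {F E : Type} [Field F] [NumberField F] [Field E] [NumberField E] [Algebra F E] {c : E ≃ₐ[F] E}

/-- **Unique representability for `E ⊂ 𝔸_E` is stable under translation of the domain** (`ξ + z ∈ v + D ↔ ξ + (z − v) ∈ D`). [folklore] -/
theorem existsUnique_add_algebraMap_mem_vadd {D : Set (AdeleRing (𝓞 E) E)}
    (hD : ∀ z : AdeleRing (𝓞 E) E, ∃! ξ : E, algebraMap E (AdeleRing (𝓞 E) E) ξ + z ∈ D) (v z : AdeleRing (𝓞 E) E) :
    ∃! ξ : E, algebraMap E (AdeleRing (𝓞 E) E) ξ + z ∈ v +ᵥ D := by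
  have e : ∀ ξ : E, algebraMap E (AdeleRing (𝓞 E) E) ξ + z ∈ v +ᵥ D ↔ algebraMap E (AdeleRing (𝓞 E) E) ξ + (z - v) ∈ D := fun ξ => by
    rw [Set.mem_vadd_set_iff_neg_vadd_mem, vadd_eq_add]
    constructor <;> intro h <;> convert h using 1 <;> abel
  exact (existsUnique_congr e).2 (hD (z - v))

/-- A uniquely-representing Borel domain `D ⊆ 𝔸_E` (Tate's form `∀ z, ∃! ξ ∈ E, ξ + z ∈ D`) is a measurable fundamental domain for the translation action of the
principal adeles, for every measure (Mathlib `IsAddFundamentalDomain.mk'`). [cite: CasselsFrohlichANT1967, Ch. XV Thm. 4.1.3 (1)] -/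
theorem isAddFundamentalDomain_of_existsUnique_add_algebraMap [MeasurableSpace (AdeleRing (𝓞 E) E)] {D : Set (AdeleRing (𝓞 E) E)} (hDm : MeasurableSet D)
    (hD : ∀ z : AdeleRing (𝓞 E) E, ∃! ξ : E, algebraMap E (AdeleRing (𝓞 E) E) ξ + z ∈ D) (ν : Measure (AdeleRing (𝓞 E) E)) :
    IsAddFundamentalDomain (AdeleRing.principalSubgroup (𝓞 E) E) D ν := by
  refine IsAddFundamentalDomain.mk' hDm.nullMeasurableSet fun z => ?_
  obtain ⟨ξ, hξ, huniq⟩ := hD z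
  refine ⟨⟨algebraMap E _ ξ, ξ, rfl⟩, hξ, ?_⟩
  rintro ⟨g, ξ', rfl⟩ hg
  have : ξ' = ξ := huniq ξ' hg
  subst this
  rfl

/-- **Unique representability for `E ⊂ 𝔸_E` is stable under negation of the domain** (`ξ + z ∈ −D ↔ (−ξ) + (−z) ∈ D`; `ξ ↦ −ξ` is a bijection of `E`). [folklore] -/
theorem existsUnique_add_algebraMap_mem_neg {D : Set (AdeleRing (𝓞 E) E)}
    (hD : ∀ z : AdeleRing (𝓞 E) E, ∃! ξ : E, algebraMap E (AdeleRing (𝓞 E) E) ξ + z ∈ D) (z : AdeleRing (𝓞 E) E) :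
    ∃! ξ : E, algebraMap E (AdeleRing (𝓞 E) E) ξ + z ∈ -D := by
  have e : ∀ ξ : E, algebraMap E (AdeleRing (𝓞 E) E) ξ + z ∈ -D ↔ algebraMap E (AdeleRing (𝓞 E) E) (-ξ) + (-z) ∈ D := fun ξ => by
    rw [Set.mem_neg, map_neg, neg_add]
  obtain ⟨ξ₀, hξ₀, huniq⟩ := hD (-z)
  refine ⟨-ξ₀, (e _).2 (by rw [neg_neg]; exact hξ₀), fun ξ hξ => ?_⟩
  rw [← neg_neg ξ, huniq _ ((e ξ).1 hξ)]

omit [NumberField F] in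
/-- **Unique representability for `E⁻ ⊂ 𝔸_E⁻` is stable under negation of the domain.** [folklore] -/
theorem existsUnique_vadd_mem_neg {D : Set (traceZeroAdele F E c)}
    (hD : ∀ s : traceZeroAdele F E c, ∃! g : rationalTraceZero F E c, g +ᵥ s ∈ D) (s : traceZeroAdele F E c) :
    ∃! g : rationalTraceZero F E c, g +ᵥ s ∈ -D := by
  have e : ∀ g : rationalTraceZero F E c, g +ᵥ s ∈ -D ↔ (-g) +ᵥ (-s) ∈ D := fun g => by
    rw [Set.mem_neg, AddSubgroup.vadd_def, AddSubgroup.vadd_def, vadd_eq_add, vadd_eq_add, AddSubgroup.coe_neg, neg_add]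
  obtain ⟨g₀, hg₀, huniq⟩ := hD (-s)
  refine ⟨-g₀, (e _).2 (by rw [neg_neg]; exact hg₀), fun g hg => ?_⟩
  rw [← neg_neg g, huniq _ ((e g).1 hg)]

/-- Membership in `u(D_Q × D_Z)` in coordinates: `x(w) ∈ D_Q` and `y(w) ∈ D_Z`. [cite: Rogawski1990, §1.10 p. 9] -/
theorem mem_heisChart_image_prod_iff (hc : c * c = 1) (DQ : Set (AdeleRing (𝓞 E) E)) (DZ : Set (traceZeroAdele F E c)) (w : adelicUnipotent F E c 3) :
    w ∈ heisChart hc '' (DQ ×ˢ DZ) ↔ coordX w ∈ DQ ∧ coordY hc w ∈ DZ := by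
  constructor
  · rintro ⟨p, ⟨hp1, hp2⟩, rfl⟩
    rw [coordX_heisChart, coordY_heisChart]
    exact ⟨hp1, hp2⟩
  · rintro ⟨h1, h2⟩
    exact ⟨(coordX w, coordY hc w), ⟨h1, h2⟩, heisChart_coord hc w⟩

/-- **`u(D_Q × D_Z)` IS A FUNDAMENTAL DOMAIN OF `N(F)` IN `N(𝔸_F)`** whenever `D_Q ⊆ 𝔸_E` is uniquely representing for `E` (`∀ z, ∃! ξ ∈ E, ξ + z ∈ D_Q`) and `D_Z ⊆ 𝔸_E⁻`
is uniquely representing for `E⁻` (`∀ s, ∃! γ ∈ E⁻, γ + s ∈ D_Z`): every `w ∈ N(𝔸_F)` has exactly one left `N(F)`-translate in `u(D_Q × D_Z)` — the unique `x₀ ∈ E` with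
`x₀ + x(w) ∈ D_Q`, then the unique `y₀ ∈ E⁻` bringing the centre coordinate of `u(x₀, ·) · w` into `D_Z`.  ★ p856148 `existsUnique_smul_mem_heisChart_image` is the case
`(D_Q, D_Z) = (v + D_E, 𝓕⁻)`; the proof is that one verbatim. [cite: Rogawski1990, §2.1 p. 12] [cite: CasselsFrohlichANT1967, Ch. XV Thm. 4.1.3] -/
theorem existsUnique_smul_mem_heisChart_image_prod (hc : c * c = 1) {DQ : Set (AdeleRing (𝓞 E) E)} {DZ : Set (traceZeroAdele F E c)}
    (hQ : ∀ z : AdeleRing (𝓞 E) E, ∃! ξ : E, algebraMap E (AdeleRing (𝓞 E) E) ξ + z ∈ DQ)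
    (hZ : ∀ s : traceZeroAdele F E c, ∃! g : rationalTraceZero F E c, g +ᵥ s ∈ DZ) (w : adelicUnipotent F E c 3) :
    ∃! γ : rationalUnipotent F E c 3, γ • w ∈ heisChart hc '' (DQ ×ˢ DZ) := by
  haveI : Nontrivial (AdeleRing (𝓞 E) E) := inferInstanceAs (Nontrivial (InfiniteAdeleRing E × FiniteAdeleRing (𝓞 E) E))
  obtain ⟨ξ, hξ, hξuniq⟩ := hQ (coordX w)
  have h0 : c (0 : E) = -0 := by rw [map_zero, neg_zero]
  -- the centre coordinate `s` of `u(ξ, 0) · w`; the coordinates of `u(ξ, y₀) · w` are `(ξ + x(w), y₀ + s)`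
  obtain ⟨s, hs⟩ : ∃ s : traceZeroAdele F E c, s = coordY hc ((ratHeisElt hc ξ h0 : rationalUnipotent F E c 3) • w) := ⟨_, rfl⟩
  have hY : ∀ (y₀ : E) (hy₀ : c y₀ = -y₀), ((coordY hc ((ratHeisElt hc ξ hy₀ : rationalUnipotent F E c 3) • w) : traceZeroAdele F E c) :
      AdeleRing (𝓞 E) E) = algebraMap E (AdeleRing (𝓞 E) E) y₀ + (s : AdeleRing (𝓞 E) E) := fun y₀ hy₀ => by
    rw [hs, coe_coordY_ratHeisElt_smul, coe_coordY_ratHeisElt_smul, map_zero, zero_add]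
  obtain ⟨g, hg, hguniq⟩ := hZ s
  obtain ⟨η, hη⟩ := (mem_rationalTraceZero_iff _).1 g.2
  have hηc : c η = -η := by
    have h := (mem_traceZeroAdele_iff _).1 (g : traceZeroAdele F E c).2
    rw [← hη, ← algebraMap_conj, RingHom.coe_coe, ← map_neg] at h
    exact (algebraMap E (AdeleRing (𝓞 E) E)).injective h
  refine ⟨ratHeisElt hc ξ hηc, ?_, ?_⟩
  · change (ratHeisElt hc ξ hηc : rationalUnipotent F E c 3) • w ∈ _
    rw [mem_heisChart_image_prod_iff, coordX_ratHeisElt_smul]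
    refine ⟨hξ, ?_⟩
    have heq : coordY hc ((ratHeisElt hc ξ hηc : rationalUnipotent F E c 3) • w) = g +ᵥ s :=
      Subtype.ext (by rw [hY]; change _ = ((g : traceZeroAdele F E c) : AdeleRing (𝓞 E) E) + (s : AdeleRing (𝓞 E) E); rw [hη])
    rw [heq]
    exact hg
  · intro γ' hγ'
    change γ' • w ∈ _ at hγ'
    obtain ⟨ξ', η', hη'c, rfl⟩ := exists_eq_ratHeisElt hc γ'
    rw [mem_heisChart_image_prod_iff, coordX_ratHeisElt_smul] at hγ'
    have hξ' : ξ' = ξ := hξuniq ξ' hγ'.1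
    subst hξ'
    obtain ⟨g', hg'⟩ : ∃ g' : rationalTraceZero F E c,
        g' = ⟨⟨algebraMap E (AdeleRing (𝓞 E) E) η', algebraMap_mem_traceZeroAdele hη'c⟩, η', rfl⟩ := ⟨_, rfl⟩
    have hg's : g' +ᵥ s ∈ DZ := by
      have heq : (g' +ᵥ s : traceZeroAdele F E c) = coordY hc ((ratHeisElt hc ξ' hη'c : rationalUnipotent F E c 3) • w) :=
        Subtype.ext (by rw [hY, hg']; rfl)
      rw [heq]
      exact hγ'.2
    have hgg : g' = g := hguniq g' hg's
    have hηη : η' = η := by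
      have h1 := congrArg (fun z : rationalTraceZero F E c => ((z : traceZeroAdele F E c) : AdeleRing (𝓞 E) E)) hgg
      change ((g' : traceZeroAdele F E c) : AdeleRing (𝓞 E) E) = ((g : traceZeroAdele F E c) : AdeleRing (𝓞 E) E) at h1
      rw [hg', ← hη] at h1
      exact (algebraMap E (AdeleRing (𝓞 E) E)).injective h1
    subst hηη
    rfl

/-- `u(D_Q × D_Z)` lies in a compact set when `D_Q` and `D_Z` do. [cite: CasselsFrohlichANT1967, Ch. XV Cor. 4.1.1] -/
theorem isCompact_closure_heisChart_image_prod (hc : c * c = 1) {DQ KQ : Set (AdeleRing (𝓞 E) E)} {DZ KZ : Set (traceZeroAdele F E c)}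
    (hKQ : IsCompact KQ) (hDQ : DQ ⊆ KQ) (hKZ : IsCompact KZ) (hDZ : DZ ⊆ KZ) :
    IsCompact (closure (heisChart hc '' (DQ ×ˢ DZ))) :=
  ((hKQ.prod hKZ).image (heisChart hc).continuous).closure_of_subset (Set.image_mono (Set.prod_mono hDQ hDZ))

/-- `u(D_Q × D_Z)` is a Borel set when `D_Q` and `D_Z` are. [folklore] -/
theorem measurableSet_heisChart_image_prod [MeasurableSpace (AdeleRing (𝓞 E) E)] [BorelSpace (AdeleRing (𝓞 E) E)]
    [MeasurableSpace (adelicUnipotent F E c 3)] [BorelSpace (adelicUnipotent F E c 3)] (hc : c * c = 1)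
    {DQ : Set (AdeleRing (𝓞 E) E)} {DZ : Set (traceZeroAdele F E c)} (hDQ : MeasurableSet DQ) (hDZ : MeasurableSet DZ) :
    MeasurableSet (heisChart hc '' (DQ ×ˢ DZ)) := by
  haveI := secondCountableTopology_adeleRing E
  haveI : SecondCountableTopology (traceZeroAdele F E c) := TopologicalSpace.Subtype.secondCountableTopology _
  have e : heisChart hc '' (DQ ×ˢ DZ) = (heisChart hc).toMeasurableEquiv '' (DQ ×ˢ DZ) := rfl
  rw [e, MeasurableEquiv.measurableSet_image]
  exact hDQ.prod hDZ

/-- **Inverses in the chart**: `u(x, y)⁻¹ = u(−x, −y)` (the commutator cocycle `½(x c(x) − x c(x))` vanishes on the pair `(x, −x)`; ★ `coordX_mul_heisChart`, ★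
`coe_coordY_mul_heisChart`) — the dictionary between the convention `[g · u(x, y)⁻¹]` of B2₃ (★ p856148) and the convention `[x · u(x, y)]` of B3Z (★ p856217) ∕ B3Q.
[cite: Rogawski1990, §1.10 p. 9] -/
theorem heisChart_inv (hc : c * c = 1) (x : AdeleRing (𝓞 E) E) (y : traceZeroAdele F E c) :
    (heisChart hc (x, y))⁻¹ = heisChart hc (-x, -y) := by
  have hX : coordX (heisChart hc (x, y))⁻¹ = -x := by rw [coordX_inv, coordX_heisChart]
  have hY : coordY hc (heisChart hc (x, y))⁻¹ = -y := Subtype.ext (by rw [coe_coordY_inv, coordY_heisChart]; rfl)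
  calc (heisChart hc (x, y))⁻¹ = heisChart hc (coordX (heisChart hc (x, y))⁻¹, coordY hc (heisChart hc (x, y))⁻¹) := (heisChart_coord hc _).symm
    _ = heisChart hc (-x, -y) := by rw [hX, hY]

/-- Hence `[g · u(x, y)⁻¹] = [g · u(−x, −y)]` on the automorphic quotient — the convention of ★ p856148 (B2₃) read in the convention of ★ p856217 (B3Z) ∕ B3Q.
[cite: Rogawski1990, §1.10 p. 9] -/
theorem toAutomorphicQuotient_mul_heisChart_inv (hc : c * c = 1) (g : (quasiSplit F E c 3).Adelic) (x : AdeleRing (𝓞 E) E) (y : traceZeroAdele F E c) :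
    (quasiSplit F E c 3).toAutomorphicQuotient (g * ((heisChart hc (x, y) : adelicUnipotent F E c 3) : (quasiSplit F E c 3).Adelic)⁻¹) =
      (quasiSplit F E c 3).toAutomorphicQuotient (g * ((heisChart hc (-x, -y) : adelicUnipotent F E c 3) : (quasiSplit F E c 3).Adelic)) := by
  rw [← Subgroup.coe_inv, heisChart_inv]

end Heisenberg

end Summit.HodgeConjecture.HodgeConjecture.Cruxes.H413.K2E1SiegelStepDomainsU3

end
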